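import Literature.NumberTheory.Transcendental.SixExponentialsSeveralVariablesThm41Proofs
import Literature.NumberTheory.Transcendental.TorusZeroEstimateHolds

/-!
# Discharge of named literature fact(s) by composition

This file only composes reductions and discharges that are already in the tree
(no new definitions, no new named facts): each `theorem X_holds : X` below feeds the
proved hypotheses into an existing reduction theorem.  Net effect: the listed facts
stop being literature debt.
-/

namespace Literature.NumberTheory.Transcendental.Waldschmidt1981

/-- Discharge of `thm_4_1` (Waldschmidt 1981, Thm. 4.1) from Philippon's proved zero estimate on
the torus (`Philippon1986_zeroEstimate_torus_holds`) via `thm_4_1_of_zeroEstimate_torus`.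
[cite: Waldschmidt1981, §4 Théorème 4.1 (p. 105)] -/
theorem thm_4_1_holds : thm_4_1 :=
  thm_4_1_of_zeroEstimate_torus Philippon1986_zeroEstimate_torus_holds

end Literature.NumberTheory.Transcendental.Waldschmidt1981
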